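import Literature.NumberTheory.EllipticCurves.ZpExtensionEisensteinDVRSettingH4RestrictedAdjointProofs
import Literature.NumberTheory.EllipticCurves.TowerLocalH1LiftExactProofs
import HarnessLib

/-!
# H.4 at the places `v ∣ p` for the curve's Eisenstein setting, VIII: FREE-INDEX transfer forms of the tower identities
# (components of compatible families along `F (b+1) (a+1)`, `p^{b−a} ξ_b = H¹(F) ξ_a`, `he_red` along `F`, the projection
# formula along `F`) — the level inputs `UP/DOWN/UP′/DOWN′/hAdj` of (EXACT-REP)

`Proofs` file (theorems only; no definition, no named fact, no instance, no `sorry`).  Sequel of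
`ZpExtensionEisensteinDVRSettingH4AdjointProofs` / `…H4RestrictedAdjointProofs` (the `(k, d)`-indexed forms with `red^{(d)}`).

The generic (EXACT-REP) theorem `Tower.exists_sub_pow_smul_forall_pairing_eq_zero` (x9-p1-w2, `TowerSaturatedExactRepProofs`) is
indexed by the levels `k + 1 + i` of the `D`-indexed towers `X_j = H¹(K_v, T^{(j)})`, `Y_j = H¹(K_v, Tw T^{(j)})` and asks for level
maps `UP_i : X_k → X_{k+1+i}`, `DOWN_i : Y_{k+1+i} → Y_k`, `UP′_i : X_i → X_{k+1+i}`, `DOWN′_i : Y_{k+1+i} → Y_i` with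
`p^{i+1} ξ_{k+1+i} = UP_i ξ_k`, `DOWN_i η_{k+1+i} = η_k`, … on compatible families and the projection formulas.  For the curve's tower
these are `H¹` of the TWO-INDEX maps `F a b = eisensteinTwistTorsionTransfer a b` (division for `a < b`, iterated reduction for
`b ≤ a`) between ARBITRARY levels, so this file restates the tower identities with free indices `a ≤ b` (no `red^{(d)}`, no `k + d`):

* §0 `galoisCohomology.map_eq_pow_smul_of_apply` (`H¹` of «`w ↦ p^c w`» is `p^c ·`);
* §1 `eisensteinTower_map_transfer_apply_of_mem_compatibleFamilies[_twist]` (`H¹(F (b+1) (a+1)) ξ_b = ξ_a` on compatible families),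
  `eisensteinTower_pow_smul_apply_eq_map_transfer[_twist]` (`p^{b−a} ξ_b = H¹(F (a+1) (b+1)) ξ_a`);
* (sequel `…H4TransferAdjointProofs`: `he_red` and the projection formula along `F`, free indices).

Cell `pub/bsd-print-x9` (STUB A `hfin4` at `v ∣ p`, (EXACT-REP-INST)).  No summit statement is proved here; BSD is not proved by any
of this.  References: [Howard2004HeegnerKolyvagin] Def. 1.1.3, §1.3 H.4, §1.6 (arXiv:1202.6340 p. 5, p. 7 L78–82, p. 11 L33–38,
p. 12 L29–33); [NeukirchSchmidtWingberg2008] I §4 (1.4.2)–(1.4.6); [SerreGaloisCohomology1997] I §2.2.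
-/

set_option autoImplicit false

noncomputable section

open Function NumberField IsDedekindDomain Field CategoryTheory
open scoped NumberField ContRepresentation

/-! ## §0 `H¹` of the multiplication by `p^c` -/

namespace Literature.NumberTheory.GaloisRepresentations.galoisCohomology

open Literature.NumberTheory.GaloisRepresentations.DiscreteGaloisModule

/-- **`H¹` of a map acting as `w ↦ p^c · w` is `p^c ·` on `H¹`** (the class of `p^c φ`).
[cite: SerreGaloisCohomology1997, Ch. I §2.2 and §5.1] -/
theorem map_eq_pow_smul_of_apply {L : Type} [Field L] {M : Type} [AddCommGroup M] [TopologicalSpace M] [DiscreteTopology M]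
    {ρ : DiscreteGaloisModule L M} (g : ρ.toContRepresentation →ⁱL ρ.toContRepresentation) (p c : ℕ)
    (hg : ∀ w, g w = p ^ c • w) (x : galoisCohomology ρ 1) :
    galoisCohomology.map g 1 x = p ^ c • x := by
  have hρ : ρ.IsScalarLinear ℤ := fun σ n m ↦ map_zsmul _ n m
  rw [map_congr_apply g (scalarIntertwining ρ hρ ((p ^ c : ℕ) : ℤ)) (fun w ↦ by
    rw [hg, scalarIntertwining_apply, natCast_zsmul]) x]
  exact (scalarMapH1_intCast ρ hρ ((p ^ c : ℕ) : ℤ) x).trans (natCast_zsmul x (p ^ c))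

end Literature.NumberTheory.GaloisRepresentations.galoisCohomology

namespace WeierstrassCurve

open Literature.NumberTheory.EllipticCurves Literature.NumberTheory.GaloisRepresentations
open Literature.NumberTheory.GaloisRepresentations.DiscreteGaloisModule
open Literature.NumberTheory.GaloisCohomology Literature.NumberTheory.GaloisCohomology.Howard2004
open Literature.NumberTheory.EllipticCurves.ZpExtension (EisensteinLevel)

variable {K : Type} [Field K] [NumberField K] (W : WeierstrassCurve ℚ) [W.IsElliptic] {p : ℕ} [hp : Fact p.Prime]
  (κ : ZpExtension K p) {m : ℕ} (hm : 1 ≤ m)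

/-! ## §1 Components of compatible families along the two-index maps -/

/-- **`H¹(K_v, F (b+1) (a+1)) ξ_b = ξ_a` for a compatible family of the `D`-indexed tower** (`a ≤ b`; the iterated reduction of the
two-index family IS the composite of the one-step reductions). [cite: Howard2004HeegnerKolyvagin, Def. 1.1.3 and §1.6 (arXiv p. 12, L29–33)]
[cite: SerreGaloisCohomology1997, Ch. I §2.2] -/
theorem eisensteinTower_map_transfer_apply_of_mem_compatibleFamilies (v : Place K) {a b : ℕ} (hab : a ≤ b)
    {ξ : Π j, letI := IwasawaAlgebra.isLocalRing_quotient_X_pow_add_C p hm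
      galoisCohomology (((W.eisensteinTower κ hm).ρ j).toLocal v) 1}
    (hξ : letI := IwasawaAlgebra.isLocalRing_quotient_X_pow_add_C p hm
      ξ ∈ Tower.compatibleFamilies (H := fun j ↦ galoisCohomology (((W.eisensteinTower κ hm).ρ j).toLocal v) 1)
        (fun j ↦ ContinuousRep.cohomologyMap (((W.eisensteinTower κ hm).ρ (j + 1)).toLocal v)
          (((W.eisensteinTower κ hm).ρ j).toLocal v) ((W.eisensteinTower κ hm).red j).toAddMonoidHom
          continuous_of_discreteTopology (fun _ z => (W.eisensteinTower κ hm).red_equivariant j _ z) 1)) :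
    letI := IwasawaAlgebra.isLocalRing_quotient_X_pow_add_C p hm
    galoisCohomology.map (DiscreteGaloisModule.localMap
        ((W.baseChange K).eisensteinTwistTorsionTransfer κ hm (fun j ↦ (W.baseChange K).torsionGaloisModuleReduce p j)
          (W.torsionGaloisModuleReduce_coe (K := K) (p := p)) (b + 1) (a + 1)) v) 1 (ξ b) = ξ a := by
  letI := IwasawaAlgebra.isLocalRing_quotient_X_pow_add_C p hm
  obtain ⟨d, rfl⟩ := Nat.exists_eq_add_of_le hab
  induction d with
  | zero =>
    exact Tower.map_apply_eq_self_of_forall_apply_eq (F := Place.Completion v) _ (fun w ↦ by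
      rw [DiscreteGaloisModule.localMap_apply, eisensteinTwistTorsionTransfer_eq, ZpExtension.eisensteinTwistTransfer_self]) _
  | succ d ih =>
    have hc := (Tower.mem_compatibleFamilies_iff _ ξ).1 hξ (a + d)
    -- one step: `H¹(F (a+d+2) (a+d+1)) ξ_{a+d+1} = red ξ_{a+d+1} = ξ_{a+d}`
    have hstep : galoisCohomology.map (DiscreteGaloisModule.localMap
        ((W.baseChange K).eisensteinTwistTorsionTransfer κ hm (fun j ↦ (W.baseChange K).torsionGaloisModuleReduce p j)
          (W.torsionGaloisModuleReduce_coe (K := K) (p := p)) (a + d + 1 + 1) (a + d + 1)) v) 1 (ξ (a + d + 1)) = ξ (a + d) := by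
      rw [galoisCohomology.map_congr_apply _ (DiscreteGaloisModule.localMap (ZpExtension.eisensteinTwistReduce κ hm
        (Nat.le_succ (a + d + 1)) ((W.baseChange K).torsionGaloisModuleReduce p (a + d + 1))) v) (fun w ↦ by
          rw [DiscreteGaloisModule.localMap_apply, DiscreteGaloisModule.localMap_apply, eisensteinTwistTorsionTransfer_eq,
            ZpExtension.eisensteinTwistTransfer_succ_self])]
      exact hc
    calc galoisCohomology.map (DiscreteGaloisModule.localMap
            ((W.baseChange K).eisensteinTwistTorsionTransfer κ hm (fun j ↦ (W.baseChange K).torsionGaloisModuleReduce p j)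
              (W.torsionGaloisModuleReduce_coe (K := K) (p := p)) (a + d + 1 + 1) (a + 1)) v) 1 (ξ (a + d + 1))
        = galoisCohomology.map (DiscreteGaloisModule.localMap
            ((W.baseChange K).eisensteinTwistTorsionTransfer κ hm (fun j ↦ (W.baseChange K).torsionGaloisModuleReduce p j)
              (W.torsionGaloisModuleReduce_coe (K := K) (p := p)) (a + d + 1) (a + 1)) v) 1
            (galoisCohomology.map (DiscreteGaloisModule.localMap
              ((W.baseChange K).eisensteinTwistTorsionTransfer κ hm (fun j ↦ (W.baseChange K).torsionGaloisModuleReduce p j)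
                (W.torsionGaloisModuleReduce_coe (K := K) (p := p)) (a + d + 1 + 1) (a + d + 1)) v) 1 (ξ (a + d + 1))) :=
          (galoisCohomology.map_map_of_comp_apply _ _ _ (fun w ↦ by
            rw [DiscreteGaloisModule.localMap_apply, DiscreteGaloisModule.localMap_apply, DiscreteGaloisModule.localMap_apply,
              eisensteinTwistTorsionTransfer_eq, eisensteinTwistTorsionTransfer_eq, eisensteinTwistTorsionTransfer_eq,
              ZpExtension.eisensteinTwistTransfer_comp _ _ _ _ _ _ _ (Nat.succ_le_succ (Nat.le_add_right a d))
                (Nat.le_succ (a + d + 1))]) _).symm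
      _ = ξ a := by rw [hstep]; exact ih (Nat.le_add_right a d)

/-- **`H¹(K_v, Tw F (b+1) (a+1)) η_b = η_a` for a compatible family of the TWISTED `D`-indexed tower** (`a ≤ b`).
[cite: Howard2004HeegnerKolyvagin, Def. 1.1.3, §1.3 (Tw) and §1.6 (arXiv p. 12, L29–33)] [cite: SerreGaloisCohomology1997, Ch. I §2.2] -/
theorem eisensteinTower_map_transfer_apply_of_mem_compatibleFamilies_twist (cd : ConjugationDatum K) (v : Place K) {a b : ℕ}
    (hab : a ≤ b)
    {η : Π j, letI := IwasawaAlgebra.isLocalRing_quotient_X_pow_add_C p hm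
      galoisCohomology ((cd.twist ((W.eisensteinTower κ hm).ρ j)).toLocal v) 1}
    (hη : letI := IwasawaAlgebra.isLocalRing_quotient_X_pow_add_C p hm
      η ∈ Tower.compatibleFamilies (H := fun j ↦ galoisCohomology ((cd.twist ((W.eisensteinTower κ hm).ρ j)).toLocal v) 1)
        (fun j ↦ ContinuousRep.cohomologyMap ((cd.twist ((W.eisensteinTower κ hm).ρ (j + 1))).toLocal v)
          ((cd.twist ((W.eisensteinTower κ hm).ρ j)).toLocal v) ((W.eisensteinTower κ hm).red j).toAddMonoidHom
          continuous_of_discreteTopology (fun _ z => (W.eisensteinTower κ hm).red_equivariant j _ z) 1)) :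
    letI := IwasawaAlgebra.isLocalRing_quotient_X_pow_add_C p hm
    galoisCohomology.map (DiscreteGaloisModule.localMap (DiscreteGaloisModule.restrictMap
        ((W.baseChange K).eisensteinTwistTorsionTransfer κ hm (fun j ↦ (W.baseChange K).torsionGaloisModuleReduce p j)
          (W.torsionGaloisModuleReduce_coe (K := K) (p := p)) (b + 1) (a + 1)) cd.conj) v) 1 (η b) = η a := by
  letI := IwasawaAlgebra.isLocalRing_quotient_X_pow_add_C p hm
  obtain ⟨d, rfl⟩ := Nat.exists_eq_add_of_le hab
  induction d with
  | zero =>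
    exact Tower.map_apply_eq_self_of_forall_apply_eq (F := Place.Completion v) _ (fun w ↦ by
      rw [DiscreteGaloisModule.localMap_apply, DiscreteGaloisModule.restrictMap_apply, eisensteinTwistTorsionTransfer_eq,
        ZpExtension.eisensteinTwistTransfer_self]) _
  | succ d ih =>
    have hc := (Tower.mem_compatibleFamilies_iff _ η).1 hη (a + d)
    have hstep : galoisCohomology.map (DiscreteGaloisModule.localMap (DiscreteGaloisModule.restrictMap
        ((W.baseChange K).eisensteinTwistTorsionTransfer κ hm (fun j ↦ (W.baseChange K).torsionGaloisModuleReduce p j)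
          (W.torsionGaloisModuleReduce_coe (K := K) (p := p)) (a + d + 1 + 1) (a + d + 1)) cd.conj) v) 1 (η (a + d + 1)) = η (a + d) := by
      rw [galoisCohomology.map_congr_apply _ (DiscreteGaloisModule.localMap (DiscreteGaloisModule.restrictMap
        (ZpExtension.eisensteinTwistReduce κ hm (Nat.le_succ (a + d + 1)) ((W.baseChange K).torsionGaloisModuleReduce p (a + d + 1)))
        cd.conj) v) (fun w ↦ by
          rw [DiscreteGaloisModule.localMap_apply, DiscreteGaloisModule.localMap_apply, DiscreteGaloisModule.restrictMap_apply,
            DiscreteGaloisModule.restrictMap_apply, eisensteinTwistTorsionTransfer_eq, ZpExtension.eisensteinTwistTransfer_succ_self])]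
      exact hc
    calc galoisCohomology.map (DiscreteGaloisModule.localMap (DiscreteGaloisModule.restrictMap
            ((W.baseChange K).eisensteinTwistTorsionTransfer κ hm (fun j ↦ (W.baseChange K).torsionGaloisModuleReduce p j)
          (W.torsionGaloisModuleReduce_coe (K := K) (p := p)) (a + d + 1 + 1) (a + 1)) cd.conj) v) 1 (η (a + d + 1))
        = galoisCohomology.map (DiscreteGaloisModule.localMap (DiscreteGaloisModule.restrictMap
            ((W.baseChange K).eisensteinTwistTorsionTransfer κ hm (fun j ↦ (W.baseChange K).torsionGaloisModuleReduce p j)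
          (W.torsionGaloisModuleReduce_coe (K := K) (p := p)) (a + d + 1) (a + 1)) cd.conj) v) 1
            (galoisCohomology.map (DiscreteGaloisModule.localMap (DiscreteGaloisModule.restrictMap
              ((W.baseChange K).eisensteinTwistTorsionTransfer κ hm (fun j ↦ (W.baseChange K).torsionGaloisModuleReduce p j)
          (W.torsionGaloisModuleReduce_coe (K := K) (p := p)) (a + d + 1 + 1) (a + d + 1)) cd.conj) v) 1 (η (a + d + 1))) :=
          (galoisCohomology.map_map_of_comp_apply _ _ _ (fun w ↦ by
            rw [DiscreteGaloisModule.localMap_apply, DiscreteGaloisModule.localMap_apply, DiscreteGaloisModule.localMap_apply,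
              DiscreteGaloisModule.restrictMap_apply, DiscreteGaloisModule.restrictMap_apply, DiscreteGaloisModule.restrictMap_apply,
              eisensteinTwistTorsionTransfer_eq, eisensteinTwistTorsionTransfer_eq, eisensteinTwistTorsionTransfer_eq,
              ZpExtension.eisensteinTwistTransfer_comp _ _ _ _ _ _ _ (Nat.succ_le_succ (Nat.le_add_right a d))
                (Nat.le_succ (a + d + 1))]) _).symm
      _ = η a := by rw [hstep]; exact ih (Nat.le_add_right a d)

/-- **`p^{b−a} • ξ_b = H¹(K_v, F (a+1) (b+1)) ξ_a`** for a compatible family of the `D`-indexed tower (`a ≤ b`): the division after the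
reduction is the multiplication by `p^{b−a}`. [cite: Howard2004HeegnerKolyvagin, Def. 1.1.3 (arXiv Def. 2.1.3) and §1.6]
[cite: SerreGaloisCohomology1997, Ch. I §2.2] -/
theorem eisensteinTower_pow_smul_apply_eq_map_transfer (v : Place K) {a b : ℕ} (hab : a ≤ b)
    {ξ : Π j, letI := IwasawaAlgebra.isLocalRing_quotient_X_pow_add_C p hm
      galoisCohomology (((W.eisensteinTower κ hm).ρ j).toLocal v) 1}
    (hξ : letI := IwasawaAlgebra.isLocalRing_quotient_X_pow_add_C p hm
      ξ ∈ Tower.compatibleFamilies (H := fun j ↦ galoisCohomology (((W.eisensteinTower κ hm).ρ j).toLocal v) 1)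
        (fun j ↦ ContinuousRep.cohomologyMap (((W.eisensteinTower κ hm).ρ (j + 1)).toLocal v)
          (((W.eisensteinTower κ hm).ρ j).toLocal v) ((W.eisensteinTower κ hm).red j).toAddMonoidHom
          continuous_of_discreteTopology (fun _ z => (W.eisensteinTower κ hm).red_equivariant j _ z) 1)) :
    letI := IwasawaAlgebra.isLocalRing_quotient_X_pow_add_C p hm
    p ^ (b - a) • ξ b = galoisCohomology.map (DiscreteGaloisModule.localMap
        ((W.baseChange K).eisensteinTwistTorsionTransfer κ hm (fun j ↦ (W.baseChange K).torsionGaloisModuleReduce p j)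
          (W.torsionGaloisModuleReduce_coe (K := K) (p := p)) (a + 1) (b + 1)) v) 1 (ξ a) := by
  letI := IwasawaAlgebra.isLocalRing_quotient_X_pow_add_C p hm
  rw [← W.eisensteinTower_map_transfer_apply_of_mem_compatibleFamilies κ hm v hab hξ,
    galoisCohomology.map_map_of_comp_apply _ _ ((Literature.NumberTheory.EllipticCurves.DiscreteGaloisModule.localMap
        ((W.baseChange K).eisensteinTwistTorsionTransfer κ hm (fun j ↦ (W.baseChange K).torsionGaloisModuleReduce p j)
          (W.torsionGaloisModuleReduce_coe (K := K) (p := p)) (a + 1) (b + 1)) v).comp (Literature.NumberTheory.EllipticCurves.DiscreteGaloisModule.localMap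
        ((W.baseChange K).eisensteinTwistTorsionTransfer κ hm (fun j ↦ (W.baseChange K).torsionGaloisModuleReduce p j)
          (W.torsionGaloisModuleReduce_coe (K := K) (p := p)) (b + 1) (a + 1)) v)) (fun _ ↦ rfl),
    galoisCohomology.map_eq_pow_smul_of_apply _ p (b - a) (fun w ↦ by
      change ((W.baseChange K).eisensteinTwistTorsionTransfer κ hm (fun j ↦ (W.baseChange K).torsionGaloisModuleReduce p j)
          (W.torsionGaloisModuleReduce_coe (K := K) (p := p)) (a + 1) (b + 1)) (((W.baseChange K).eisensteinTwistTorsionTransfer κ hm (fun j ↦ (W.baseChange K).torsionGaloisModuleReduce p j)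
          (W.torsionGaloisModuleReduce_coe (K := K) (p := p)) (b + 1) (a + 1)) w) = _
      rw [eisensteinTwistTorsionTransfer_eq, eisensteinTwistTorsionTransfer_eq,
        ZpExtension.eisensteinTwistTransfer_apply_apply _ _ _ _ _ _ _ (Nat.succ_le_succ hab), Nat.succ_sub_succ])]
  rfl

/-- The same for the twisted tower: **`p^{b−a} • η_b = H¹(K_v, Tw F (a+1) (b+1)) η_a`**.
[cite: Howard2004HeegnerKolyvagin, Def. 1.1.3, §1.3 (Tw) and §1.6] [cite: SerreGaloisCohomology1997, Ch. I §2.2] -/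
theorem eisensteinTower_pow_smul_apply_eq_map_transfer_twist (cd : ConjugationDatum K) (v : Place K) {a b : ℕ} (hab : a ≤ b)
    {η : Π j, letI := IwasawaAlgebra.isLocalRing_quotient_X_pow_add_C p hm
      galoisCohomology ((cd.twist ((W.eisensteinTower κ hm).ρ j)).toLocal v) 1}
    (hη : letI := IwasawaAlgebra.isLocalRing_quotient_X_pow_add_C p hm
      η ∈ Tower.compatibleFamilies (H := fun j ↦ galoisCohomology ((cd.twist ((W.eisensteinTower κ hm).ρ j)).toLocal v) 1)
        (fun j ↦ ContinuousRep.cohomologyMap ((cd.twist ((W.eisensteinTower κ hm).ρ (j + 1))).toLocal v)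
          ((cd.twist ((W.eisensteinTower κ hm).ρ j)).toLocal v) ((W.eisensteinTower κ hm).red j).toAddMonoidHom
          continuous_of_discreteTopology (fun _ z => (W.eisensteinTower κ hm).red_equivariant j _ z) 1)) :
    letI := IwasawaAlgebra.isLocalRing_quotient_X_pow_add_C p hm
    p ^ (b - a) • η b = galoisCohomology.map (DiscreteGaloisModule.localMap (DiscreteGaloisModule.restrictMap
        ((W.baseChange K).eisensteinTwistTorsionTransfer κ hm (fun j ↦ (W.baseChange K).torsionGaloisModuleReduce p j)
          (W.torsionGaloisModuleReduce_coe (K := K) (p := p)) (a + 1) (b + 1)) cd.conj) v) 1 (η a) := by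
  letI := IwasawaAlgebra.isLocalRing_quotient_X_pow_add_C p hm
  rw [← W.eisensteinTower_map_transfer_apply_of_mem_compatibleFamilies_twist κ hm cd v hab hη,
    galoisCohomology.map_map_of_comp_apply _ _ ((Literature.NumberTheory.EllipticCurves.DiscreteGaloisModule.localMap (DiscreteGaloisModule.restrictMap
        ((W.baseChange K).eisensteinTwistTorsionTransfer κ hm (fun j ↦ (W.baseChange K).torsionGaloisModuleReduce p j)
          (W.torsionGaloisModuleReduce_coe (K := K) (p := p)) (a + 1) (b + 1)) cd.conj) v).comp (Literature.NumberTheory.EllipticCurves.DiscreteGaloisModule.localMap (DiscreteGaloisModule.restrictMap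
        ((W.baseChange K).eisensteinTwistTorsionTransfer κ hm (fun j ↦ (W.baseChange K).torsionGaloisModuleReduce p j)
          (W.torsionGaloisModuleReduce_coe (K := K) (p := p)) (b + 1) (a + 1)) cd.conj) v)) (fun _ ↦ rfl),
    galoisCohomology.map_eq_pow_smul_of_apply _ p (b - a) (fun w ↦ by
      change ((W.baseChange K).eisensteinTwistTorsionTransfer κ hm (fun j ↦ (W.baseChange K).torsionGaloisModuleReduce p j)
          (W.torsionGaloisModuleReduce_coe (K := K) (p := p)) (a + 1) (b + 1)) (((W.baseChange K).eisensteinTwistTorsionTransfer κ hm (fun j ↦ (W.baseChange K).torsionGaloisModuleReduce p j)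
          (W.torsionGaloisModuleReduce_coe (K := K) (p := p)) (b + 1) (a + 1)) w) = _
      rw [eisensteinTwistTorsionTransfer_eq, eisensteinTwistTorsionTransfer_eq,
        ZpExtension.eisensteinTwistTransfer_apply_apply _ _ _ _ _ _ _ (Nat.succ_le_succ hab), Nat.succ_sub_succ])]
  rfl

end WeierstrassCurve

end
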